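import Literature.NumberTheory.EllipticCurves.RationalIsogenyFrobeniusCriterion
import Literature.NumberTheory.EllipticCurves.RationalIsogenyFrobeniusCertificatesGenusOne
import HarnessLib

/-!
# Crux `MazurKenkuBound` (stmt-ABC-15125), line `radius-lite` ⊕ `Sketch` — stub
# `stub_certThirteenComposite`: no rational `13`-isogeny out of the `j`-tables of `X₀(21)`, `X₀(27)`

Kenku 1982, proof of Thm. 1, at the two radius levels `273 = 21·13` and `351 = 27·13`: a cyclic
`ℚ`-isogeny of degree `273` (resp. `351`) would give, out of one elliptic curve over `ℚ`, a cyclic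
rational `21`- (resp. `27`-) isogeny — so `j` is in the table of `X₀(21)`,
`j ∈ {-3²·5⁶/2³, 3³·5³/2, -3²·5³·101³/2²¹, -3³·5³·383³/2⁷}`, resp. of `X₀(27)`, `j = -2¹⁵·3·5³`
(Mazur 1978, table p. 129) — and a rational `13`-isogeny. The latter is refuted, `j` by `j`, by a
Frobenius certificate (Mazur 1978, Prop. 6.3 (1)): for the globally minimal integer model `E₀`
with that `j` and a good prime `ℓ ≠ 13`, `X² − a_ℓX + ℓ` must have a root modulo `13`, and it has
none.

All the arithmetic is in the landed criterion
`Literature.NumberTheory.EllipticCurves.j_ne_of_isogeny_prime_degree_of_certificate'`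
(`RationalIsogenyFrobeniusCriterion.lean`) and the kernel-decided point counts
`KenkuLevelsCert.card_E21_*_7` (`RationalIsogenyFrobeniusCertificatesGenusOne.lean`) plus the one
point count `card_E27_jm12288000_5` decided below; this file only feeds them the five rows of data:

* `j = -140625/8`: `E₀ = [1, -1, 1, -5, 5]`, `Δ = -2³·3⁴`, `ℓ = 7`, `#Ẽ₀(𝔽₇) = 6` (`a₇ = 2`);
* `j = 3375/2`: `E₀ = [1, -1, 0, 3, -1]`, `Δ = -2·3⁶`, `ℓ = 7`, `#Ẽ₀(𝔽₇) = 6` (`a₇ = 2`);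
* `j = -1159088625/2097152`: `E₀ = [1, -1, 1, -95, -697]`, `Δ = -2²¹·3⁴`, `ℓ = 7`, `#Ẽ₀(𝔽₇) = 6`
  (`a₇ = 2`);
* `j = -189613868625/128`: `E₀ = [1, -1, 0, -1077, 13877]`, `Δ = -2⁷·3⁶`, `ℓ = 7`, `#Ẽ₀(𝔽₇) = 6`
  (`a₇ = 2`);
* `j = -12288000`: `E₀ = [0, 0, 1, -30, 63]` (CM, conductor `27`), `Δ = -3⁵`, `ℓ = 5`,
  `#Ẽ₀(𝔽₅) = 6` (`a₅ = 0`);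

`X² − 2X + 7` (discriminant `-24 ≡ 2`) and `X² + 5` (`-5 ≡ 8`) are root-free modulo `13`
(`2` and `8` are non-residues modulo `13`; `decide`). (At `ℓ = 7` the CM curve has `a₇ = -1` and
`X² + X + 7` does have a root modulo `13`, whence the witness `ℓ = 5` in the last row.)

## References

* [Mazur1978] B. Mazur, *Rational isogenies of prime degree*, Invent. Math. 44 (1978) 129–162,
  §6 Prop. 6.3 (1) (p. 153), Thm. 1 and the table p. 129 (`X₀(21)`, `X₀(27)`).
* [Kenku1982] M. A. Kenku, *On the number of ℚ-isomorphism classes of elliptic curves in each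
  ℚ-isogeny class*, J. Number Theory 15 (1982) 199–202, proof of Thm. 1, p. 201.
-/

-- `Summit.ABC.ABC` is the mandated summit-side namespace (CONVENTIONS §2); the duplicate is deliberate.
set_option linter.dupNamespace false

noncomputable section

open scoped Classical
open WeierstrassCurve
open Literature.NumberTheory.EllipticCurves

namespace Summit.ABC.ABC.Theorems

/-- `#Ẽ(𝔽₅) = 6`, i.e. `a₅ = 0`, for `E = [0, 0, 1, -30, 63]` (`j = -12288000 = -2¹⁵·3·5³`; table
`X₀(27)`, minimal discriminant `-243`, conductor `27`, CM by the order of discriminant `-27`): the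
affine points of `y² + y = x³ + 3` over `𝔽₅` are `(2,2), (3,0), (3,4), (4,1), (4,3)`. Witness prime
for the level `351 = 27·13`. [folklore] -/
private theorem card_E27_jm12288000_5 :
    Nat.card (((⟨0, 0, 1, -30, 63⟩ : WeierstrassCurve ℤ).map
      (Int.castRingHom (ZMod 5))).toAffine.Point) = 6 := by
  rw [@WeierstrassCurve.natCard_point_eq_one_add_card (ZMod 5) (@ZMod.instField 5 ⟨by norm_num⟩)
    _ _ _ (by decide +kernel), @card_sol_eq_sum_euler (ZMod 5) (@ZMod.instField 5 ⟨by norm_num⟩)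
    _ _ (by rw [ZMod.ringChar_zmod_n]; decide), ZMod.card]
  decide +kernel

/-- No `ℚ`-isogeny of degree `13` out of an elliptic curve over `ℚ` with `j = -140625/8 = -3²·5⁶/2³`
(table `X₀(21)`; model `[1, -1, 1, -5, 5]`, `Δ = -2³·3⁴`, witness prime `ℓ = 7`, `a₇ = 2`:
`X² − 2X + 7` has no root modulo `13`). [cite: Mazur1978, §6 Prop. 6.3 (1) (p. 153)]
[cite: Kenku1982, proof of Thm. 1, p. 201] -/
private theorem j_ne_jm140625d8 {W W' : WeierstrassCurve ℚ} [W.IsElliptic] [W'.IsElliptic]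
    (ψ : Isogeny W W') (hq : ψ.degree = 13) : W.j ≠ -140625 / 8 := by
  have hj : (((⟨1, -1, 1, -5, 5⟩ : WeierstrassCurve ℤ)).c₄ : ℚ) ^ 3 /
      (((⟨1, -1, 1, -5, 5⟩ : WeierstrassCurve ℤ)).Δ : ℚ) = -140625 / 8 := by
    norm_num [WeierstrassCurve.Δ, WeierstrassCurve.c₄, WeierstrassCurve.b₂, WeierstrassCurve.b₄,
      WeierstrassCurve.b₆, WeierstrassCurve.b₈]
  -- the root-freeness certificate, decided BEFORE any local `Fact` instance is introduced
  -- (a local `Fact (Nat.Prime q)` would be picked up by `Fintype (ZMod q)` and block `decide`)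
  have hnr13 : ∀ t : ZMod 13,
      t ^ 2 - (((7 : ℕ) : ℤ) + 1 - (6 : ℕ) : ℤ) * t + ((7 : ℕ) : ZMod 13) ≠ 0 := by
    decide +kernel
  rw [← hj]
  haveI : Fact (Nat.Prime 7) := ⟨by norm_num⟩
  haveI : Fact (Nat.Prime 13) := ⟨by norm_num⟩
  exact j_ne_of_isogeny_prime_degree_of_certificate' _ (B := 2) (by decide +kernel)
    (by decide +kernel) (by decide +kernel) (by decide +kernel) (ℓ := 7) (by decide +kernel)
    KenkuLevelsCert.card_E21_jm140625d8_7 (q := 13) (by norm_num) hnr13 ψ hq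

/-- No `ℚ`-isogeny of degree `13` out of an elliptic curve over `ℚ` with `j = 3375/2 = 3³·5³/2`
(table `X₀(21)`; model `[1, -1, 0, 3, -1]`, `Δ = -2·3⁶`, witness prime `ℓ = 7`, `a₇ = 2`:
`X² − 2X + 7` has no root modulo `13`). [cite: Mazur1978, §6 Prop. 6.3 (1) (p. 153)]
[cite: Kenku1982, proof of Thm. 1, p. 201] -/
private theorem j_ne_j3375d2 {W W' : WeierstrassCurve ℚ} [W.IsElliptic] [W'.IsElliptic]
    (ψ : Isogeny W W') (hq : ψ.degree = 13) : W.j ≠ 3375 / 2 := by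
  have hj : (((⟨1, -1, 0, 3, -1⟩ : WeierstrassCurve ℤ)).c₄ : ℚ) ^ 3 /
      (((⟨1, -1, 0, 3, -1⟩ : WeierstrassCurve ℤ)).Δ : ℚ) = 3375 / 2 := by
    norm_num [WeierstrassCurve.Δ, WeierstrassCurve.c₄, WeierstrassCurve.b₂, WeierstrassCurve.b₄,
      WeierstrassCurve.b₆, WeierstrassCurve.b₈]
  have hnr13 : ∀ t : ZMod 13,
      t ^ 2 - (((7 : ℕ) : ℤ) + 1 - (6 : ℕ) : ℤ) * t + ((7 : ℕ) : ZMod 13) ≠ 0 := by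
    decide +kernel
  rw [← hj]
  haveI : Fact (Nat.Prime 7) := ⟨by norm_num⟩
  haveI : Fact (Nat.Prime 13) := ⟨by norm_num⟩
  exact j_ne_of_isogeny_prime_degree_of_certificate' _ (B := 2) (by decide +kernel)
    (by decide +kernel) (by decide +kernel) (by decide +kernel) (ℓ := 7) (by decide +kernel)
    KenkuLevelsCert.card_E21_j3375d2_7 (q := 13) (by norm_num) hnr13 ψ hq

/-- No `ℚ`-isogeny of degree `13` out of an elliptic curve over `ℚ` with
`j = -1159088625/2097152 = -3²·5³·101³/2²¹` (table `X₀(21)`; model `[1, -1, 1, -95, -697]`,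
`Δ = -2²¹·3⁴` — minimal: `2¹² ∣ Δ` but `2 ∤ c₄ = 4545` —, witness prime `ℓ = 7`, `a₇ = 2`:
`X² − 2X + 7` has no root modulo `13`). [cite: Mazur1978, §6 Prop. 6.3 (1) (p. 153)]
[cite: Kenku1982, proof of Thm. 1, p. 201] -/
private theorem j_ne_jm1159088625d2097152 {W W' : WeierstrassCurve ℚ} [W.IsElliptic]
    [W'.IsElliptic] (ψ : Isogeny W W') (hq : ψ.degree = 13) :
    W.j ≠ -1159088625 / 2097152 := by
  have hj : (((⟨1, -1, 1, -95, -697⟩ : WeierstrassCurve ℤ)).c₄ : ℚ) ^ 3 /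
      (((⟨1, -1, 1, -95, -697⟩ : WeierstrassCurve ℤ)).Δ : ℚ) = -1159088625 / 2097152 := by
    norm_num [WeierstrassCurve.Δ, WeierstrassCurve.c₄, WeierstrassCurve.b₂, WeierstrassCurve.b₄,
      WeierstrassCurve.b₆, WeierstrassCurve.b₈]
  have hnr13 : ∀ t : ZMod 13,
      t ^ 2 - (((7 : ℕ) : ℤ) + 1 - (6 : ℕ) : ℤ) * t + ((7 : ℕ) : ZMod 13) ≠ 0 := by
    decide +kernel
  rw [← hj]
  haveI : Fact (Nat.Prime 7) := ⟨by norm_num⟩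
  haveI : Fact (Nat.Prime 13) := ⟨by norm_num⟩
  exact j_ne_of_isogeny_prime_degree_of_certificate' _ (B := 5) (by decide +kernel)
    (by decide +kernel) (by decide +kernel) (by decide +kernel) (ℓ := 7) (by decide +kernel)
    KenkuLevelsCert.card_E21_jm1159088625d2097152_7 (q := 13) (by norm_num) hnr13 ψ hq

/-- No `ℚ`-isogeny of degree `13` out of an elliptic curve over `ℚ` with
`j = -189613868625/128 = -3³·5³·383³/2⁷` (table `X₀(21)`; model `[1, -1, 0, -1077, 13877]`,
`Δ = -2⁷·3⁶`, witness prime `ℓ = 7`, `a₇ = 2`: `X² − 2X + 7` has no root modulo `13`).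
[cite: Mazur1978, §6 Prop. 6.3 (1) (p. 153)] [cite: Kenku1982, proof of Thm. 1, p. 201] -/
private theorem j_ne_jm189613868625d128 {W W' : WeierstrassCurve ℚ} [W.IsElliptic]
    [W'.IsElliptic] (ψ : Isogeny W W') (hq : ψ.degree = 13) :
    W.j ≠ -189613868625 / 128 := by
  have hj : (((⟨1, -1, 0, -1077, 13877⟩ : WeierstrassCurve ℤ)).c₄ : ℚ) ^ 3 /
      (((⟨1, -1, 0, -1077, 13877⟩ : WeierstrassCurve ℤ)).Δ : ℚ) = -189613868625 / 128 := by
    norm_num [WeierstrassCurve.Δ, WeierstrassCurve.c₄, WeierstrassCurve.b₂, WeierstrassCurve.b₄,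
      WeierstrassCurve.b₆, WeierstrassCurve.b₈]
  have hnr13 : ∀ t : ZMod 13,
      t ^ 2 - (((7 : ℕ) : ℤ) + 1 - (6 : ℕ) : ℤ) * t + ((7 : ℕ) : ZMod 13) ≠ 0 := by
    decide +kernel
  rw [← hj]
  haveI : Fact (Nat.Prime 7) := ⟨by norm_num⟩
  haveI : Fact (Nat.Prime 13) := ⟨by norm_num⟩
  exact j_ne_of_isogeny_prime_degree_of_certificate' _ (B := 3) (by decide +kernel)
    (by decide +kernel) (by decide +kernel) (by decide +kernel) (ℓ := 7) (by decide +kernel)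
    KenkuLevelsCert.card_E21_jm189613868625d128_7 (q := 13) (by norm_num) hnr13 ψ hq

/-- No `ℚ`-isogeny of degree `13` out of an elliptic curve over `ℚ` with
`j = -12288000 = -2¹⁵·3·5³` (the point of `X₀(27)`, CM by the order of discriminant `-27`; model
`[0, 0, 1, -30, 63]`, `Δ = -3⁵`, witness prime `ℓ = 5`, `a₅ = 0`: `X² + 5` has no root modulo `13`).
[cite: Mazur1978, §6 Prop. 6.3 (1) (p. 153)] [cite: Kenku1982, proof of Thm. 1, p. 201] -/
private theorem j_ne_jm12288000 {W W' : WeierstrassCurve ℚ} [W.IsElliptic] [W'.IsElliptic]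
    (ψ : Isogeny W W') (hq : ψ.degree = 13) : W.j ≠ -12288000 := by
  have hj : (((⟨0, 0, 1, -30, 63⟩ : WeierstrassCurve ℤ)).c₄ : ℚ) ^ 3 /
      (((⟨0, 0, 1, -30, 63⟩ : WeierstrassCurve ℤ)).Δ : ℚ) = -12288000 := by
    norm_num [WeierstrassCurve.Δ, WeierstrassCurve.c₄, WeierstrassCurve.b₂, WeierstrassCurve.b₄,
      WeierstrassCurve.b₆, WeierstrassCurve.b₈]
  have hnr13 : ∀ t : ZMod 13,
      t ^ 2 - (((5 : ℕ) : ℤ) + 1 - (6 : ℕ) : ℤ) * t + ((5 : ℕ) : ZMod 13) ≠ 0 := by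
    decide +kernel
  rw [← hj]
  haveI : Fact (Nat.Prime 5) := ⟨by norm_num⟩
  haveI : Fact (Nat.Prime 13) := ⟨by norm_num⟩
  exact j_ne_of_isogeny_prime_degree_of_certificate' _ (B := 2) (by decide +kernel)
    (by decide +kernel) (by decide +kernel) (by decide +kernel) (ℓ := 5) (by decide +kernel)
    card_E27_jm12288000_5 (q := 13) (by norm_num) hnr13 ψ hq

/-- **Kenku's radius levels `273 = 21·13` and `351 = 27·13`, per `j`.** No elliptic curve over `ℚ`
whose `j`-invariant lies in the table of `X₀(21)`,
`j ∈ {-140625/8, 3375/2, -1159088625/2097152, -189613868625/128}`, or of `X₀(27)`,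
`j = -12288000`, admits a `ℚ`-isogeny of degree `13`: by Mazur 1978, Prop. 6.3 (1), such an
isogeny out of the globally minimal models `[1,-1,1,-5,5]`, `[1,-1,0,3,-1]`, `[1,-1,1,-95,-697]`,
`[1,-1,0,-1077,13877]`, `[0,0,1,-30,63]` would force a root of `X² − a_ℓX + ℓ` modulo `13` at the
good primes `ℓ = 7, 7, 7, 7, 5` (`a₇ = 2`, `a₅ = 0`), and there is none.
[cite: Mazur1978, §6 Prop. 6.3 (1) (p. 153)] [cite: Kenku1982, proof of Thm. 1, p. 201] -/
theorem stub_certThirteenComposite :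
    ∀ (W W' : WeierstrassCurve ℚ) [W.IsElliptic] [W'.IsElliptic] (ψ : Isogeny W W'),
      ψ.degree = 13 →
        W.j ∉ ({-140625 / 8, 3375 / 2, -1159088625 / 2097152, -189613868625 / 128, -12288000} :
          Finset ℚ) := by
  intro W W' _ _ ψ hq hmem
  simp only [Finset.mem_insert, Finset.mem_singleton] at hmem
  rcases hmem with h | h | h | h | h
  · exact j_ne_jm140625d8 ψ hq h
  · exact j_ne_j3375d2 ψ hq h
  · exact j_ne_jm1159088625d2097152 ψ hq h
  · exact j_ne_jm189613868625d128 ψ hq h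
  · exact j_ne_jm12288000 ψ hq h

end Summit.ABC.ABC.Theorems

end
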